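import Mathlib
import HarnessLib
import Summits.NavierStokesRegularity.NavierStokesRegularity.Theorems.LocalHelicityTubeDoorFrobeniusProfileRigidityExtremalBlowDown
import Summits.NavierStokesRegularity.NavierStokesRegularity.Theorems.PoloidalWindowDoorPoloidalWindowRigidityPoloidalExtremalRecurrent

/-!
# Door S11 `LocalTubeDoorHelicity`, crux K2⁗ `FrobeniusProfileRigidity` — EXTREMAL AND SELF-RECURRENT normal form for an
# invariant sub-class (generic; part 2: Birkhoff recurrence, reduction) and the FROBENIUS instance

Cell ns-regularity-ideate, seat p6 (route-directed support for the door route `route-helicity`; lands `--supports` the K2⁗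
item; no claim on the crux).  Continues `…FrobeniusProfileRigidityExtremalBlowDown` (part 1).  The K2 lead's
`…PoloidalExtremalRecurrent` (Zorn on the closed blow-down-invariant subsets of the compact image of the extremal set under
evaluation at a dense sequence), `…PoloidalExtremalSelfRecurrent` and `…PoloidalExtremalReduction`, with the sub-class
predicate `P` abstracted (translation-, `nsRescale`-, backward-time-shift-invariant, closed under the KNSS `C¹_loc` limits):

* `exists_selfBlowDown_of_subclass` — Birkhoff: if every element of `𝓔 = {W ∈ 𝔓(C) : P W, ‖W(−1,0)‖ = C}` has a blow-down in
  `𝓔` (and `𝓔 ≠ ∅`), some `W ∈ 𝓔` is a blow-down OF ITSELF;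
* `exists_selfRecurrent_extremal_of_subclass` — a nontrivial `P`-element ⇒ an extremal SELF-RECURRENT `P`-element;
* `rigidity_of_no_extremal_recurrent_of_subclass` — REDUCTION: «no extremal self-recurrent `P`-element» ⇒ every `P`-element
  of the Type-I Oseen-mild class is not backward-singular at the apex;
* `helicityFree_timeShift`, `frobeniusProfileRigidity_of_no_extremal_recurrent` — **K2⁗ (profile form, verbatim the `hprofile`
  binder of `localTubeDoorHelicity_of_profileRigidity`) ⇐ «no extremal self-recurrent helicity-free profile»**: a K2⁗ residue
  prover may work with a profile that attains its sub-class-sharp Type-I constant at the hot spot `(−1,0)` AND is recurrent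
  under blow-down modulo translations.

SUPPORT EDGE (route-NavierStokesRegularity-LocalHelicityTubeDoor born; director-ns g6 #1 (5)): this file is re-pointed
`--supports stmt-NavierStokesRegularity-19975 --as helper` (nsreg-p6 g6 p482893: generic extremal self-recurrent normal form + Frobenius instance); it was parked on the
CLOSED fallback anchor stmt-NavierStokesRegularity-20018 while the route was unborn.  Declarations unchanged.

WHAT THIS IS NOT: not a claim about Navier–Stokes regularity and not K2⁗ — a normal form (compactness + symmetry + Zorn, no new
mechanism) for a door route's open profile crux (bears_on LADDER-NS N0, door S11).
-/

noncomputable section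

-- the summit and its single sub-problem share the name (CONVENTIONS §1), as in every Theorems file
set_option linter.dupNamespace false

namespace Summit.NavierStokesRegularity.NavierStokesRegularity.Theorems.LocalHelicityTubeDoorFrobeniusProfileRigidityExtremalRecurrent

open MeasureTheory Set Function Filter Topology
open scoped RealInnerProductSpace InnerProductSpace
open Literature.Analysis Literature.Analysis.FluidPDE
open Summit.NavierStokesRegularity.NavierStokesRegularity.Theorems
open Summit.NavierStokesRegularity.NavierStokesRegularity.Theorems.ExtremalSpiralSymmetry.Registered
open Summit.NavierStokesRegularity.NavierStokesRegularity.Theorems.PoloidalWindowDoorPoloidalWindowRigidityPoloidalExtremal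
open Summit.NavierStokesRegularity.NavierStokesRegularity.Theorems.PoloidalWindowDoorPoloidalWindowRigidityWindow
open Summit.NavierStokesRegularity.NavierStokesRegularity.Theorems.PoloidalWindowDoorPoloidalWindowRigidityFlat
open Summit.NavierStokesRegularity.NavierStokesRegularity.Theorems.LocalHelicityTubeDoorFrobeniusProfileRigidityExtremal
open Summit.NavierStokesRegularity.NavierStokesRegularity.Theorems.LocalHelicityTubeDoorFrobeniusProfileRigidityExtremalBlowDown

variable {P : (ℝ → EuclideanSpace ℝ (Fin 3) → EuclideanSpace ℝ (Fin 3)) → Prop}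

/-! ### Birkhoff recurrence -/

/-- **Birkhoff recurrence for blow-downs inside the sub-class (core)**: if the set
`𝓔 = {W ∈ 𝔓(C) : P W, ‖W(−1,0)‖ = C}` is nonempty and every element has a blow-down in `𝓔`, then some `W ∈ 𝓔` is a blow-down of
itself (Zorn on the closed blow-down-invariant subsets of the compact image of `𝓔` under evaluation at a dense sequence). -/
theorem exists_selfBlowDown_of_subclass
    (hPlim : ∀ (V : ℕ → ℝ → EuclideanSpace ℝ (Fin 3) → EuclideanSpace ℝ (Fin 3))
      (W : ℝ → EuclideanSpace ℝ (Fin 3) → EuclideanSpace ℝ (Fin 3)), (∀ k, P (V k)) →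
      (∀ t < 0, ∀ x, Tendsto (fun k => V k t x) atTop (𝓝 (W t x))) →
      (∀ t < 0, ∀ x, Tendsto (fun k => fderiv ℝ (V k t) x) atTop (𝓝 (fderiv ℝ (W t) x))) → P W)
    {C : ℝ}
    (hne : ∃ W : ℝ → EuclideanSpace ℝ (Fin 3) → EuclideanSpace ℝ (Fin 3), IsTypeIAncientMild C W ∧ P W ∧ ‖W (-1) 0‖ = C)
    (hbd : ∀ W : ℝ → EuclideanSpace ℝ (Fin 3) → EuclideanSpace ℝ (Fin 3),
      IsTypeIAncientMild C W → P W → ‖W (-1) 0‖ = C →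
      ∃ W' : ℝ → EuclideanSpace ℝ (Fin 3) → EuclideanSpace ℝ (Fin 3),
        IsTypeIAncientMild C W' ∧ P W' ∧ ‖W' (-1) 0‖ = C ∧
        ∃ (lam : ℕ → ℝ) (xs : ℕ → EuclideanSpace ℝ (Fin 3)), (∀ j, 0 < lam j) ∧ Tendsto lam atTop atTop ∧
          ∀ t < (0 : ℝ), ∀ x, Tendsto (fun j => lam j • W (lam j ^ 2 * t) (xs j + lam j • x)) atTop
            (𝓝 (W' t x))) :
    ∃ W : ℝ → EuclideanSpace ℝ (Fin 3) → EuclideanSpace ℝ (Fin 3),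
      IsTypeIAncientMild C W ∧ P W ∧ ‖W (-1) 0‖ = C ∧
      ∃ (lam : ℕ → ℝ) (xs : ℕ → EuclideanSpace ℝ (Fin 3)), (∀ j, 0 < lam j) ∧ Tendsto lam atTop atTop ∧
        ∀ t < (0 : ℝ), ∀ x, Tendsto (fun j => lam j • W (lam j ^ 2 * t) (xs j + lam j • x)) atTop
          (𝓝 (W t x)) := by
  obtain ⟨q, hq, hqd⟩ := exists_dense_seq_slab
  set E : Set (ℝ → EuclideanSpace ℝ (Fin 3) → EuclideanSpace ℝ (Fin 3)) :=
    {W | IsTypeIAncientMild C W ∧ P W ∧ ‖W (-1) 0‖ = C} with hE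
  set ι : (ℝ → EuclideanSpace ℝ (Fin 3) → EuclideanSpace ℝ (Fin 3)) → (ℕ → EuclideanSpace ℝ (Fin 3)) :=
    fun W n => W (q n).1 (q n).2 with hι
  set S : Set (ℕ → EuclideanSpace ℝ (Fin 3)) := ι '' E with hS
  set BD : (ℝ → EuclideanSpace ℝ (Fin 3) → EuclideanSpace ℝ (Fin 3)) →
      (ℝ → EuclideanSpace ℝ (Fin 3) → EuclideanSpace ℝ (Fin 3)) → Prop :=
    fun W W' => ∃ (lam : ℕ → ℝ) (xs : ℕ → EuclideanSpace ℝ (Fin 3)), (∀ j, 0 < lam j) ∧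
      Tendsto lam atTop atTop ∧
      ∀ t < (0 : ℝ), ∀ x, Tendsto (fun j => lam j • W (lam j ^ 2 * t) (xs j + lam j • x)) atTop
        (𝓝 (W' t x)) with hBD
  -- (1) sequential compactness of `E` (KNSS, fields AND gradients) with `P` and the hot value preserved
  have hextract : ∀ Wi : ℕ → ℝ → EuclideanSpace ℝ (Fin 3) → EuclideanSpace ℝ (Fin 3), (∀ i, Wi i ∈ E) →
      ∃ φ : ℕ → ℕ, StrictMono φ ∧ ∃ V ∈ E,
        ∀ t < (0 : ℝ), ∀ x, Tendsto (fun i => Wi (φ i) t x) atTop (𝓝 (V t x)) := by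
    intro Wi hWi
    obtain ⟨φ, hφ, V, hV, hpt, hDpt, -, -⟩ := exists_tendsto_of_isTypeIAncientMild_seq C (fun i => (hWi i).1)
    refine ⟨φ, hφ, V, ⟨hV, hPlim (fun j => Wi (φ j)) V (fun j => (hWi (φ j)).2.1) hpt hDpt, ?_⟩, hpt⟩
    have h1 := (hpt (-1) (by norm_num) 0).norm
    have h2 : Tendsto (fun i => ‖Wi (φ i) (-1) 0‖) atTop (𝓝 C) := by
      have e : (fun i => ‖Wi (φ i) (-1) 0‖) = fun _ => C := funext fun i => (hWi (φ i)).2.2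
      rw [e]
      exact tendsto_const_nhds
    exact tendsto_nhds_unique h1 h2
  -- (2) pointwise convergence on the slab gives convergence of the evaluations
  have hιtend : ∀ (Wi : ℕ → ℝ → EuclideanSpace ℝ (Fin 3) → EuclideanSpace ℝ (Fin 3))
      (V : ℝ → EuclideanSpace ℝ (Fin 3) → EuclideanSpace ℝ (Fin 3)),
      (∀ t < (0 : ℝ), ∀ x, Tendsto (fun i => Wi i t x) atTop (𝓝 (V t x))) →
      Tendsto (fun i => ι (Wi i)) atTop (𝓝 (ι V)) := fun Wi V h =>
    tendsto_pi_nhds.2 fun n => h (q n).1 (hq n) (q n).2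
  -- (3) `S` is compact
  have hSseq : IsSeqCompact S := by
    intro y hy
    choose Wi hWiE hWiy using hy
    obtain ⟨φ, hφ, V, hVE, hpt⟩ := hextract Wi hWiE
    refine ⟨ι V, ⟨V, hVE, rfl⟩, φ, hφ, ?_⟩
    have h := hιtend (fun i => Wi (φ i)) V hpt
    have e : (fun i => ι (Wi (φ i))) = y ∘ φ := funext fun i => hWiy (φ i)
    rwa [e] at h
  have hScpt : IsCompact S := hSseq.isCompact
  -- (4) the admissible family: nonempty closed subsets of `S` invariant under blow-downs
  set A : Set (Set (ℕ → EuclideanSpace ℝ (Fin 3))) :=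
    {F | F ⊆ S ∧ F.Nonempty ∧ IsClosed F ∧ ∀ W ∈ E, ι W ∈ F → ∀ W' ∈ E, BD W W' → ι W' ∈ F} with hA
  obtain ⟨W₀, hW₀⟩ := hne
  have hW₀E : W₀ ∈ E := hW₀
  have hSA : S ∈ A :=
    ⟨subset_rfl, ⟨ι W₀, W₀, hW₀E, rfl⟩, hScpt.isClosed, fun W _ _ W' hW' _ => ⟨W', hW', rfl⟩⟩
  have hchain : ∀ c ⊆ A, IsChain (· ⊆ ·) c → ∃ lb ∈ A, ∀ s ∈ c, lb ⊆ s := by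
    intro c hcA hc
    rcases c.eq_empty_or_nonempty with rfl | hcne
    · exact ⟨S, hSA, by simp⟩
    refine ⟨⋂₀ c, ⟨?_, ?_, ?_, ?_⟩, fun s hs => sInter_subset_of_mem hs⟩
    · obtain ⟨s, hs⟩ := hcne
      exact (sInter_subset_of_mem hs).trans (hcA hs).1
    · haveI : Nonempty c := hcne.to_subtype
      have hdir : DirectedOn (· ⊇ ·) c := by
        intro a ha b hb
        rcases hc.total ha hb with hab | hba
        · exact ⟨a, ha, subset_rfl, hab⟩
        · exact ⟨b, hb, hba, subset_rfl⟩
      exact IsCompact.nonempty_sInter_of_directed_nonempty_isCompact_isClosed hdir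
        (fun s hs => (hcA hs).2.1) (fun s hs => hScpt.of_isClosed_subset (hcA hs).2.2.1 (hcA hs).1)
        (fun s hs => (hcA hs).2.2.1)
    · exact isClosed_sInter fun s hs => (hcA hs).2.2.1
    · intro W hW hWF W' hW' hbd'
      rw [mem_sInter] at hWF ⊢
      exact fun s hs => (hcA hs).2.2.2 W hW (hWF s hs) W' hW' hbd'
  -- (5) a minimal admissible set
  obtain ⟨F, hFmin⟩ := zorn_superset A hchain
  have hF : F ∈ A := hFmin.prop
  obtain ⟨y, hy⟩ := hF.2.1
  obtain ⟨W, hWE, hWy⟩ := hF.1 hy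
  set G : Set (ℕ → EuclideanSpace ℝ (Fin 3)) := ι '' {W' | W' ∈ E ∧ BD W W'} with hG
  have hGF : G ⊆ F := by
    rintro _ ⟨W', ⟨hW'E, hbd'⟩, rfl⟩
    exact hF.2.2.2 W hWE (hWy ▸ hy) W' hW'E hbd'
  have hGne : G.Nonempty := by
    obtain ⟨W', hW'A, hW'p, hW'n, hbd'⟩ := hbd W hWE.1 hWE.2.1 hWE.2.2
    exact ⟨ι W', W', ⟨⟨hW'A, hW'p, hW'n⟩, hbd'⟩, rfl⟩
  have hGclosed : IsClosed G := by
    refine IsSeqClosed.isClosed fun z p hz hzp => ?_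
    choose Wi hWi hWiz using hz
    obtain ⟨φ, hφ, V, hVE, hpt⟩ := hextract Wi (fun i => (hWi i).1)
    have hιV : Tendsto (fun i => ι (Wi (φ i))) atTop (𝓝 (ι V)) := hιtend _ _ hpt
    have hzφ : Tendsto (fun i => z (φ i)) atTop (𝓝 p) := hzp.comp hφ.tendsto_atTop
    have e : (fun i => ι (Wi (φ i))) = fun i => z (φ i) := funext fun i => hWiz (φ i)
    rw [e] at hιV
    have hp : p = ι V := tendsto_nhds_unique hzφ hιV
    refine ⟨V, ⟨hVE, ?_⟩, hp.symm⟩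
    exact blowDown_of_tendsto hWE.1 (W' := fun i => Wi (φ i)) (fun i => (hWi (φ i)).2) hVE.1 hpt
  have hGinv : ∀ W₁ ∈ E, ι W₁ ∈ G → ∀ W₂ ∈ E, BD W₁ W₂ → ι W₂ ∈ G := by
    rintro W₁ hW₁ ⟨W₃, ⟨hW₃E, hbd₃⟩, hW₃₁⟩ W₂ hW₂ hbd₁₂
    have heq : ∀ t < (0 : ℝ), ∀ x, W₃ t x = W₁ t x :=
      eqOn_slab_of_eq_on_dense_seq hq hqd hW₃E.1 hW₁.1 (fun n => congr_fun hW₃₁ n)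
    have hbdW₁ : BD W W₁ := by
      obtain ⟨lam, xs, hp, ht, hc⟩ := hbd₃
      exact ⟨lam, xs, hp, ht, fun t ht' x => (heq t ht' x) ▸ hc t ht' x⟩
    exact ⟨W₂, ⟨hW₂, blowDown_trans hWE.1 hW₂.1 hbdW₁ hbd₁₂⟩, rfl⟩
  have hGA : G ∈ A := ⟨hGF.trans hF.1, hGne, hGclosed, hGinv⟩
  have hGeq : G = F := Subset.antisymm hGF (hFmin.2 hGA hGF)
  have hWG : ι W ∈ G := by rw [hGeq, hWy]; exact hy
  obtain ⟨W', ⟨hW'E, hbdW'⟩, hW'W⟩ := hWG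
  have heq' : ∀ t < (0 : ℝ), ∀ x, W' t x = W t x :=
    eqOn_slab_of_eq_on_dense_seq hq hqd hW'E.1 hWE.1 (fun n => congr_fun hW'W n)
  obtain ⟨lam, xs, hp, ht, hc⟩ := hbdW'
  exact ⟨W, hWE.1, hWE.2.1, hWE.2.2, lam, xs, hp, ht, fun t ht' x => (heq' t ht' x) ▸ hc t ht' x⟩

/-! ### The extremal self-recurrent element, and the reduction -/

/-- **An extremal SELF-RECURRENT element of the sub-class exists** (under the four closure properties): if some `P`-element of
some KNSS Type-I class is nontrivial, then there are `C⋆ > 0` and an extremal `P`-element `W ∈ 𝔓(C⋆)` (hot spot, sub-class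
minimality) with scales `λ_j → ∞` and centres `x_j` such that `λ_j W(λ_j² t, x_j + λ_j x) → W(t,x)` on the slab. -/
theorem exists_selfRecurrent_extremal_of_subclass
    (hPtr : ∀ (u : ℝ → EuclideanSpace ℝ (Fin 3) → EuclideanSpace ℝ (Fin 3)) (x₀ : EuclideanSpace ℝ (Fin 3)),
      P u → P (fun t x => u t (x₀ + x)))
    (hPsc : ∀ (u : ℝ → EuclideanSpace ℝ (Fin 3) → EuclideanSpace ℝ (Fin 3)) (c : ℝ), 0 < c → P u → P (nsRescale c u))
    (hPsh : ∀ (u : ℝ → EuclideanSpace ℝ (Fin 3) → EuclideanSpace ℝ (Fin 3)) (δ : ℝ), 0 ≤ δ → P u → P (fun t => u (t - δ)))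
    (hPlim : ∀ (V : ℕ → ℝ → EuclideanSpace ℝ (Fin 3) → EuclideanSpace ℝ (Fin 3))
      (W : ℝ → EuclideanSpace ℝ (Fin 3) → EuclideanSpace ℝ (Fin 3)), (∀ k, P (V k)) →
      (∀ t < 0, ∀ x, Tendsto (fun k => V k t x) atTop (𝓝 (W t x))) →
      (∀ t < 0, ∀ x, Tendsto (fun k => fderiv ℝ (V k t) x) atTop (𝓝 (fderiv ℝ (W t) x))) → P W)
    (hex : ∃ (C : ℝ) (u : ℝ → EuclideanSpace ℝ (Fin 3) → EuclideanSpace ℝ (Fin 3)), IsTypeIAncientMild C u ∧ P u ∧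
      ∃ t < 0, ∃ x, u t x ≠ 0) :
    ∃ (Cs : ℝ) (W : ℝ → EuclideanSpace ℝ (Fin 3) → EuclideanSpace ℝ (Fin 3)), (0 < Cs ∧ IsTypeIAncientMild Cs W ∧ P W ∧ ‖W (-1) 0‖ = Cs ∧
        ∀ (C' : ℝ) (u' : ℝ → EuclideanSpace ℝ (Fin 3) → EuclideanSpace ℝ (Fin 3)), IsTypeIAncientMild C' u' → P u' →
          (∃ t < 0, ∃ x, u' t x ≠ 0) → Cs ≤ C') ∧
      (∀ t < 0, ∀ x, Real.sqrt (-t) * ‖W t x‖ ≤ ‖W (-1) 0‖) ∧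
      ∃ (lam : ℕ → ℝ) (xs : ℕ → EuclideanSpace ℝ (Fin 3)), (∀ j, 0 < lam j) ∧ Tendsto lam atTop atTop ∧
        ∀ t < (0 : ℝ), ∀ x, Tendsto (fun j => lam j • W (lam j ^ 2 * t) (xs j + lam j • x)) atTop (𝓝 (W t x)) := by
  obtain ⟨Cs, W₀, hCs, hW₀, hP₀, hnorm₀, -, hmin⟩ := exists_extremal_of_subclass P hPtr hPsc hPlim hex
  have hbd : ∀ W : ℝ → EuclideanSpace ℝ (Fin 3) → EuclideanSpace ℝ (Fin 3),
      IsTypeIAncientMild Cs W → P W → ‖W (-1) 0‖ = Cs →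
      ∃ W' : ℝ → EuclideanSpace ℝ (Fin 3) → EuclideanSpace ℝ (Fin 3),
        IsTypeIAncientMild Cs W' ∧ P W' ∧ ‖W' (-1) 0‖ = Cs ∧
        ∃ (lam : ℕ → ℝ) (xs : ℕ → EuclideanSpace ℝ (Fin 3)), (∀ j, 0 < lam j) ∧ Tendsto lam atTop atTop ∧
          ∀ t < (0 : ℝ), ∀ x, Tendsto (fun j => lam j • W (lam j ^ 2 * t) (xs j + lam j • x)) atTop (𝓝 (W' t x)) := by
    intro W hW hp hn
    obtain ⟨lam, xs, W', hpos, htop, hconv, hext'⟩ :=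
      blowDown_extremal_of_subclass hPtr hPsc hPsh hPlim (C := Cs) (u := W) ⟨hCs, hW, hp, hn, hmin⟩
    exact ⟨W', hext'.2.1, hext'.2.2.1, hext'.2.2.2.1, lam, xs, hpos, htop, hconv⟩
  obtain ⟨W, hW, hWp, hWn, hrec⟩ := exists_selfBlowDown_of_subclass hPlim ⟨W₀, hW₀, hP₀, hnorm₀⟩ hbd
  have hhot : ∀ t < 0, ∀ x, Real.sqrt (-t) * ‖W t x‖ ≤ ‖W (-1) 0‖ := fun t ht x => by
    rw [hWn, ← le_div_iff₀' (Real.sqrt_pos.2 (neg_pos.2 ht))]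
    exact hW.norm_le ht x
  exact ⟨Cs, W, ⟨hCs, hW, hWp, hWn, hmin⟩, hhot, hrec⟩

/-- **REDUCTION to extremal self-recurrent elements**: if no `P`-element is simultaneously extremal in the sub-class (hot-spot bound,
minimality) and recurrent under blow-down modulo translations, then every `P`-element of the Type-I Oseen-mild class (rate,
continuity, unit-viscosity Oseen–Duhamel identity, divergence-free slices) is not backward-singular at the apex. -/
theorem rigidity_of_no_extremal_recurrent_of_subclass
    (hPtr : ∀ (u : ℝ → EuclideanSpace ℝ (Fin 3) → EuclideanSpace ℝ (Fin 3)) (x₀ : EuclideanSpace ℝ (Fin 3)),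
      P u → P (fun t x => u t (x₀ + x)))
    (hPsc : ∀ (u : ℝ → EuclideanSpace ℝ (Fin 3) → EuclideanSpace ℝ (Fin 3)) (c : ℝ), 0 < c → P u → P (nsRescale c u))
    (hPsh : ∀ (u : ℝ → EuclideanSpace ℝ (Fin 3) → EuclideanSpace ℝ (Fin 3)) (δ : ℝ), 0 ≤ δ → P u → P (fun t => u (t - δ)))
    (hPlim : ∀ (V : ℕ → ℝ → EuclideanSpace ℝ (Fin 3) → EuclideanSpace ℝ (Fin 3))
      (W : ℝ → EuclideanSpace ℝ (Fin 3) → EuclideanSpace ℝ (Fin 3)), (∀ k, P (V k)) →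
      (∀ t < 0, ∀ x, Tendsto (fun k => V k t x) atTop (𝓝 (W t x))) →
      (∀ t < 0, ∀ x, Tendsto (fun k => fderiv ℝ (V k t) x) atTop (𝓝 (fderiv ℝ (W t) x))) → P W)
    (hno : ∀ (Cs : ℝ) (W : ℝ → EuclideanSpace ℝ (Fin 3) → EuclideanSpace ℝ (Fin 3)), (0 < Cs ∧ IsTypeIAncientMild Cs W ∧ P W ∧ ‖W (-1) 0‖ = Cs ∧
        ∀ (C' : ℝ) (u' : ℝ → EuclideanSpace ℝ (Fin 3) → EuclideanSpace ℝ (Fin 3)), IsTypeIAncientMild C' u' → P u' →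
          (∃ t < 0, ∃ x, u' t x ≠ 0) → Cs ≤ C') →
      (∀ t < 0, ∀ x, Real.sqrt (-t) * ‖W t x‖ ≤ ‖W (-1) 0‖) →
      (∃ (lam : ℕ → ℝ) (xs : ℕ → EuclideanSpace ℝ (Fin 3)), (∀ j, 0 < lam j) ∧ Tendsto lam atTop atTop ∧
        ∀ t < (0 : ℝ), ∀ x, Tendsto (fun j => lam j • W (lam j ^ 2 * t) (xs j + lam j • x)) atTop (𝓝 (W t x))) →
      False) :
    ∀ (C : ℝ) (v : ℝ → EuclideanSpace ℝ (Fin 3) → EuclideanSpace ℝ (Fin 3)),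
      HasTypeITimeDecay C v → ContinuousOn (uncurry v) (Iio (0 : ℝ) ×ˢ univ) →
      (∀ s t : ℝ, s < t → t < 0 → ∀ x,
        v t x = UnboundedOperators.heatExtension (v s) (t - s) x - oseenDuhamel 1 s v v t x) →
      (∀ t < 0, VectorCalculus.IsDivFree (v t)) → P v →
      ¬ IsBackwardSingularPoint v 0 := by
  intro C v hrate hcont hmild hdiv hPv
  by_cases hzero : ∀ t < (0 : ℝ), ∀ y, v t y = 0
  · exact not_backwardSingular_of_zero hzero
  · push Not at hzero
    obtain ⟨t, ht, y, hy⟩ := hzero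
    have hA : IsTypeIAncientMild C v := isTypeIAncientMild_of_class hrate hcont hmild hdiv
    obtain ⟨Cs, W, hext, hhot, hrec⟩ :=
      exists_selfRecurrent_extremal_of_subclass hPtr hPsc hPsh hPlim ⟨C, v, hA, hPv, t, ht, y, hy⟩
    exact (hno Cs W hext hhot hrec).elim

/-! ### Instance: the Frobenius (helicity-free) class -/

/-- Helicity-freeness is preserved by backward time shifts (a slice property). -/
theorem helicityFree_timeShift {u : ℝ → EuclideanSpace ℝ (Fin 3) → EuclideanSpace ℝ (Fin 3)}
    (hhel : ∀ s < 0, ∀ y, ⟪u s y, curl (u s) y⟫_ℝ = 0) {δ : ℝ} (hδ : 0 ≤ δ) :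
    ∀ s < 0, ∀ y, ⟪(fun t => u (t - δ)) s y, curl ((fun t => u (t - δ)) s) y⟫_ℝ = 0 :=
  fun s hs y => hhel (s - δ) (by linarith) y

/-- **K2⁗ (profile form) ⇐ «no extremal SELF-RECURRENT helicity-free profile»** (the reduction instantiated for the Frobenius
class: `helicityFree_translate` / `_nsRescale` / `_timeShift` / `_of_tendsto`).  A K2⁗ residue prover may assume the profile is
extremal in the helicity-free sub-class (hot spot at `(−1,0)`, sub-class-sharp constant) AND recurrent under blow-down modulo
translations. -/
theorem frobeniusProfileRigidity_of_no_extremal_recurrent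
    (hno : ∀ (Cs : ℝ) (W : ℝ → EuclideanSpace ℝ (Fin 3) → EuclideanSpace ℝ (Fin 3)),
      (0 < Cs ∧ IsTypeIAncientMild Cs W ∧ (∀ s < 0, ∀ y, ⟪W s y, curl (W s) y⟫_ℝ = 0) ∧ ‖W (-1) 0‖ = Cs ∧
        ∀ (C' : ℝ) (u' : ℝ → EuclideanSpace ℝ (Fin 3) → EuclideanSpace ℝ (Fin 3)), IsTypeIAncientMild C' u' →
          (∀ s < 0, ∀ y, ⟪u' s y, curl (u' s) y⟫_ℝ = 0) → (∃ t < 0, ∃ x, u' t x ≠ 0) → Cs ≤ C') →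
      (∀ t < 0, ∀ x, Real.sqrt (-t) * ‖W t x‖ ≤ ‖W (-1) 0‖) →
      (∃ (lam : ℕ → ℝ) (xs : ℕ → EuclideanSpace ℝ (Fin 3)), (∀ j, 0 < lam j) ∧ Tendsto lam atTop atTop ∧
        ∀ t < (0 : ℝ), ∀ x, Tendsto (fun j => lam j • W (lam j ^ 2 * t) (xs j + lam j • x)) atTop (𝓝 (W t x))) →
      False) :
    ∀ (C : ℝ) (v : ℝ → EuclideanSpace ℝ (Fin 3) → EuclideanSpace ℝ (Fin 3)),
      Literature.Analysis.FluidPDE.HasTypeITimeDecay C v →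
      ContinuousOn (Function.uncurry v) (Set.Iio (0 : ℝ) ×ˢ Set.univ) →
      (∀ s t : ℝ, s < t → t < 0 → ∀ x, v t x =
        Literature.Analysis.UnboundedOperators.heatExtension (v s) (t - s) x -
          Literature.Analysis.FluidPDE.oseenDuhamel 1 s v v t x) →
      (∀ t < 0, Literature.Analysis.FluidPDE.VectorCalculus.IsDivFree (v t)) →
      (∀ s < 0, ∀ y : EuclideanSpace ℝ (Fin 3), ⟪v s y, Literature.Analysis.FluidPDE.curl (v s) y⟫_ℝ = 0) →
      ¬ Literature.Analysis.FluidPDE.IsBackwardSingularPoint v 0 :=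
  rigidity_of_no_extremal_recurrent_of_subclass (P := fun u => ∀ s < 0, ∀ y, ⟪u s y, curl (u s) y⟫_ℝ = 0)
    (fun _ x₀ h => helicityFree_translate h x₀) (fun _ _ hc h => helicityFree_nsRescale h hc)
    (fun _ _ hδ h => helicityFree_timeShift h hδ) (fun _ _ hV hpt hDpt => helicityFree_of_tendsto hV hpt hDpt) hno

end Summit.NavierStokesRegularity.NavierStokesRegularity.Theorems.LocalHelicityTubeDoorFrobeniusProfileRigidityExtremalRecurrent

end
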